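import Literature.Topology.FourManifolds.LinkingNumberProofs
import Literature.Topology.FourManifolds.LinkTubularUniqueness
import Literature.AlgebraicTopology.SingularHomology.MayerVietorisExactness
import Literature.AlgebraicTopology.SingularHomology.ExcisionTheorem
import Literature.AlgebraicTopology.SingularHomology.FundamentalClassExistence
import Literature.AlgebraicTopology.SingularHomology.NoncompactManifoldProofs
import Literature.AlgebraicTopology.SingularHomology.OrientationCover
import Literature.AlgebraicTopology.SingularHomology.DisjointUnion
import Literature.AlgebraicTopology.FundamentalGroup.SphereSimplyConnected
import HarnessLib

/-!
# The torus class of a tubular neighbourhood of a knot, and the cancellation of the torus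
# classes of a two-component link

Topic `Literature/Topology/FourManifolds`; first file of the proof of the **symmetry of the
linking number** `lk(K, J) = lk(J, K)` (the tree's named fact `Knot.HasLinkingNumber.symm`,
`LinkingNumber.lean`; D. Rolfsen, *Knots and Links* (1976), §5.D, Thm. 5.D.1) along the classical
homological route: with Rolfsen's definition (2), `lk(K, J) = [J] ∈ H₁(S³ ∖ K) ≅ ℤ`, symmetry is
the statement that the two boundary tori of the exterior `M = S³ ∖ (N(K) ∪ N(J))` of the link
cancel in `H₂`, `[∂N(K)] + [∂N(J)] = 0 ∈ H₂(S³ ∖ (K ∪ J))` (the boundary of the fundamental class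
of `M`), evaluated against the circle-valued maps `S³ ∖ K → S¹`, `S³ ∖ J → S¹` dual to the two
meridians. This file supplies the cancellation, phrased entirely through the Mayer–Vietoris
sequence of A. Hatcher, *Algebraic Topology* (2002), §2.2 (pp. 149–150), which the tree proves
(`mayerVietoris.δ`, `exact₁₂₃_holds`, `δ_naturality_holds`, `ExcisionMayerVietoris.lean`,
`MayerVietorisExactness.lean`), applied to the fundamental class `[S³] ∈ H₃(S³; ℤ)` of a
homological `ℤ`-orientation `μ` of `S³` (Hatcher Thm. 3.26; tree: `fundamentalClass`,
`isFundamentalClass_fundamentalClass_holds`).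

* `Knot.TubularNbhd.torusClass ν μ ∈ H₂(N ∖ K; ℤ)` — for an oriented tubular neighbourhood
  `ν : S¹ × ℝ² ↪ S³` of a knot `K` with open tube `N = ν(S¹ × ℝ²)`: the image of `[S³]` under the
  Mayer–Vietoris connecting map `δ : H₃(S³) → H₂(N ∩ (S³ ∖ K))` of the open cover
  `S³ = N ∪ (S³ ∖ K)` (routed, as in Hatcher p. 150, through the pair `(N, N ∖ K)`). This is the
  class of the boundary torus of a smaller tube, pushed into the punctured tube `N ∖ K ≃ T²`.
* `Knot.TubularNbhd.torusClass_ne_zero` — `torusClass ν μ ≠ 0`: `δ` is injective on `H₃(S³)`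
  because `H₃(N) = H₃(S³ ∖ K) = 0` (connected non-compact `3`-manifolds, Hatcher Prop. 3.29, tree:
  `isZero_singularHomology_of_noncompactSpace_holds`) and `[S³] ≠ 0`.
* **`Knot.TubularNbhd.map_torusClass_add_map_torusClass_eq_zero`** — for knots `K`, `J` with
  *disjoint* tubes `N_K = ν_K(S¹ × ℝ²)`, `N_J = ν_J(S¹ × ℝ²)`: in `H₂(S³ ∖ (K ∪ J); ℤ)`,
  `i_* torusClass ν_K μ + i_* torusClass ν_J μ = 0`.
  Proof: Mayer–Vietoris for the cover `(T, X')`, `T = N_K ∪ N_J`, `X' = S³ ∖ (K ∪ J)`, whose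
  intersection is the disjoint union `(N_K ∖ K) ⊔ (N_J ∖ J)`: the composite
  `H₃(S³) →δ H₂(T ∩ X') → H₂(T) ⊕ H₂(X')` vanishes (`δ ≫ φ = 0`), so `δ[S³] ↦ 0 ∈ H₂(X')`; by
  additivity (Hatcher Prop. 2.6, tree `singularHomology.sumEquiv`) `δ[S³]` splits into two
  components, and naturality of `δ` (Hatcher p. 150) for the maps of covers
  `(N_K, S³ ∖ K) → (T, S³ ∖ K) ← (T, X')`, followed by the retraction of
  `(N_K ∖ K) ⊔ N_J` onto `N_K ∖ K`, identifies the components with the two torus classes —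
  both routed through the tube side, so that no sign comparison of the two routings of `δ` is
  needed.

Everything here is proved; no definition of another file is modified and no named fact is
introduced. The sequel files identify `torusClass ν μ` with the push-forward along `ν` of one
fixed class of `H₂(S¹ × (ℝ² ∖ 0))` (the same for all oriented tubes of all knots, by the
orientation convention `det_pos`), compute the degrees of torus maps, and assemble
`Knot.HasLinkingNumber.symm_holds`.

## References

* D. Rolfsen, *Knots and Links*, Publish or Perish (1976), §5.D (definition (2) of the linking
  number; Thm. 5.D.1). [cite: Rolfsen1976, §5.D Thm 5.D.1]
* A. Hatcher, *Algebraic Topology*, CUP (2002), §2.2 pp. 149–150 (Mayer–Vietoris sequence and its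
  naturality), Prop. 2.6 (additivity), §3.3 Thm. 3.26 (fundamental class), Prop. 3.29
  (`Hₙ` of a non-compact `n`-manifold vanishes). [cite: HatcherAT2002, §2.2 pp. 149–150]
-/

open scoped Manifold ContDiff Topology
open Function Set CategoryTheory Limits
open Literature.AlgebraicTopology.SingularHomology

noncomputable section

universe u

namespace Literature.Topology.FourManifolds

/-- Local notation: `𝔼 n` is the model Euclidean space `EuclideanSpace ℝ (Fin n)`. -/
local notation "𝔼 " n:arg => EuclideanSpace ℝ (Fin n)

/-- Local notation: `𝕊 n` is the unit sphere in `EuclideanSpace ℝ (Fin (n + 1))`. -/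
local notation "𝕊 " n:arg => (Metric.sphere (0 : EuclideanSpace ℝ (Fin (n + 1))) 1)

/-! ### Generalities: constant maps, clopen retractions, disjoint unions of open subsets -/

section Generalities

variable {X Y : Type u} [TopologicalSpace X] [TopologicalSpace Y]

/-- **A constant map induces zero on `Hₙ`, `n ≠ 0`**: it factors through the one-point space,
whose positive-degree homology vanishes (Hatcher 2002, Prop. 2.8). [cite: HatcherAT2002, Prop. 2.8] -/
theorem singularHomology.map_eq_zero_of_forall_eq (f : C(X, Y)) (y₀ : Y) (hf : ∀ x, f x = y₀)
    {n : ℕ} (hn : n ≠ 0) : singularHomology.map ℤ ℤ f n = 0 := by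
  have hfac : f = (ContinuousMap.const PUnit.{u + 1} y₀).comp (ContinuousMap.const X PUnit.unit) := by
    ext x
    exact hf x
  rw [hfac, singularHomology.map_comp]
  have h0 : IsZero (singularHomology ℤ ℤ PUnit.{u + 1} n) :=
    isZero_singularHomology_of_contractibleSpace ℤ ℤ hn
  rw [h0.eq_of_src (singularHomology.map ℤ ℤ (ContinuousMap.const PUnit.{u + 1} y₀) n) 0, comp_zero]

variable {S A C D : Set X}

open Classical in
/-- **Retraction of `S` onto its clopen piece inside `C`.** For `S ⊆ C ∪ D` with `C`, `D` open and
disjoint along `S`, and `S ∩ C ⊆ A`: the map `S → A` which is the identity on `S ∩ C` and the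
constant `p₀` on `S ∩ D`; continuous since `S ∩ C` is clopen in `S`. [folklore] -/
def clopenRetract (hC : IsOpen C) (hD : IsOpen D) (hS : S ⊆ C ∪ D)
    (hCD : ∀ x ∈ S, x ∈ C → x ∉ D) (hA : ∀ x ∈ S, x ∈ C → x ∈ A) (p₀ : A) : C(S, A) where
  toFun x := ⟨if (x : X) ∈ C then (x : X) else (p₀ : X), by
    split_ifs with h
    · exact hA x x.2 h
    · exact p₀.2⟩
  continuous_toFun := by
    refine Continuous.subtype_mk ?_ _
    have hcl : IsClopen {x : S | (x : X) ∈ C} := by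
      refine ⟨⟨?_⟩, hC.preimage continuous_subtype_val⟩
      have : {x : S | (x : X) ∈ C}ᶜ = {x : S | (x : X) ∈ D} := by
        ext x
        simp only [mem_compl_iff, mem_setOf_eq]
        exact ⟨fun hx ↦ (hS x.2).resolve_left hx, fun hx hxC ↦ hCD x x.2 hxC hx⟩
      rw [this]
      exact hD.preimage continuous_subtype_val
    refine continuous_if ?_ continuous_subtype_val.continuousOn continuousOn_const
    intro a ha
    rw [hcl.frontier_eq] at ha
    exact ha.elim

/-- On `S ∩ C` the clopen retraction is the identity. [folklore] -/
theorem clopenRetract_apply_of_mem (hC : IsOpen C) (hD : IsOpen D) (hS : S ⊆ C ∪ D)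
    (hCD : ∀ x ∈ S, x ∈ C → x ∉ D) (hA : ∀ x ∈ S, x ∈ C → x ∈ A) (p₀ : A) (x : S)
    (hx : (x : X) ∈ C) : (clopenRetract hC hD hS hCD hA p₀ x : X) = x := by
  classical
  show (if (x : X) ∈ C then (x : X) else (p₀ : X)) = x
  rw [if_pos hx]

/-- On `S ∩ D` the clopen retraction is the constant `p₀`. [folklore] -/
theorem clopenRetract_apply_of_not_mem (hC : IsOpen C) (hD : IsOpen D) (hS : S ⊆ C ∪ D)
    (hCD : ∀ x ∈ S, x ∈ C → x ∉ D) (hA : ∀ x ∈ S, x ∈ C → x ∈ A) (p₀ : A) (x : S)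
    (hx : (x : X) ∉ C) : clopenRetract hC hD hS hCD hA p₀ x = p₀ := by
  classical
  apply Subtype.ext
  show (if (x : X) ∈ C then (x : X) else (p₀ : X)) = p₀
  rw [if_neg hx]

variable {B : Set X}

/-- **A subset covered by two disjoint open subsets of it is their topological sum**: the map
`A ⊕ B → S`, `S ⊆ A ∪ B`, `A, B ⊆ S` open and disjoint, is a homeomorphism. [folklore] -/
def sumHomeoOfDisjointOpen (hA : IsOpen A) (hB : IsOpen B) (hAB : Disjoint A B) (hAS : A ⊆ S)
    (hBS : B ⊆ S) (hS : S ⊆ A ∪ B) : A ⊕ B ≃ₜ S :=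
  have hinj : Function.Injective (Sum.elim (Set.inclusion hAS) (Set.inclusion hBS)) := by
    rintro (a | b) (a' | b') h
    · simp only [Sum.elim_inl] at h
      rw [Set.inclusion_inj] at h
      rw [h]
    · simp only [Sum.elim_inl, Sum.elim_inr] at h
      exact absurd (congrArg Subtype.val h) fun h' ↦ Set.disjoint_left.1 hAB a.2 (h' ▸ b'.2)
    · simp only [Sum.elim_inl, Sum.elim_inr] at h
      exact absurd (congrArg Subtype.val h) fun h' ↦ Set.disjoint_left.1 hAB a'.2 (h' ▸ b.2)
    · simp only [Sum.elim_inr] at h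
      rw [Set.inclusion_inj] at h
      rw [h]
  have hsurj : Function.Surjective (Sum.elim (Set.inclusion hAS) (Set.inclusion hBS)) := by
    intro x
    rcases hS x.2 with hx | hx
    · exact ⟨Sum.inl ⟨x, hx⟩, Subtype.ext rfl⟩
    · exact ⟨Sum.inr ⟨x, hx⟩, Subtype.ext rfl⟩
  have hAo : IsOpenMap (Set.inclusion hAS) := by
    refine (Topology.IsOpenEmbedding.inclusion hAS ?_).isOpenMap
    exact hA.preimage continuous_subtype_val
  have hBo : IsOpenMap (Set.inclusion hBS) := by
    refine (Topology.IsOpenEmbedding.inclusion hBS ?_).isOpenMap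
    exact hB.preimage continuous_subtype_val
  (Equiv.ofBijective _ ⟨hinj, hsurj⟩).toHomeomorphOfContinuousOpen
    (continuous_sum_dom.2 ⟨continuous_inclusion hAS, continuous_inclusion hBS⟩)
    (isOpenMap_sum.2 ⟨hAo, hBo⟩)

/-- **Additivity** (Hatcher 2002, Prop. 2.6; tree `singularHomology.sumEquiv`): every homology
class of a subset `S` covered by two disjoint open pieces `A`, `B` is the sum of a class pushed
from `A` and a class pushed from `B`. [cite: HatcherAT2002, Prop. 2.6] -/
theorem singularHomology.exists_eq_map_add_map_of_disjoint_open (hA : IsOpen A) (hB : IsOpen B)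
    (hAB : Disjoint A B) (hAS : A ⊆ S) (hBS : B ⊆ S) (hS : S ⊆ A ∪ B) (n : ℕ)
    (ξ : singularHomology ℤ ℤ S n) :
    ∃ (α : singularHomology ℤ ℤ A n) (β : singularHomology ℤ ℤ B n),
      ξ = singularHomology.map ℤ ℤ (subsetInclusion hAS) n α +
        singularHomology.map ℤ ℤ (subsetInclusion hBS) n β := by
  set e := sumHomeoOfDisjointOpen hA hB hAB hAS hBS hS with he
  obtain ⟨η, hη⟩ := (singularHomology.mapIso ℤ ℤ e n).toLinearEquiv.surjective ξ
  obtain ⟨⟨α, β⟩, rfl⟩ := (singularHomology.sumEquiv ℤ ℤ (↥A) (↥B) n).surjective η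
  refine ⟨α, β, ?_⟩
  rw [← hη, singularHomology.sumEquiv_apply]
  simp only [Iso.toLinearEquiv_apply, singularHomology.mapIso, map_add]
  rw [← ModuleCat.comp_apply, ← ModuleCat.comp_apply, ← singularHomology.map_comp,
    ← singularHomology.map_comp]
  rfl

end Generalities

/-! ### The round `3`-sphere: orientation and fundamental class -/

section Sphere

/-- **`S³` is `ℤ`-orientable** (simply connected manifolds are; Hatcher 2002, §3.3, Prop. 3.25
ff., tree `isOrientableOver_int_of_simplyConnectedSpace_holds`). [cite: HatcherAT2002, §3.3 Prop. 3.25] -/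
theorem isOrientableOver_int_sphere_three : IsOrientableOver ℤ (𝕊 3) 3 := by
  haveI : SimplyConnectedSpace (𝕊 3) :=
    Literature.AlgebraicTopology.FundamentalGroup.simplyConnectedSpace_euclideanSphere 3 (by norm_num)
  exact isOrientableOver_int_of_simplyConnectedSpace_holds (𝕊 3)

/-- **The fundamental class of an oriented `S³` is nonzero**: it restricts to a generator of
`H₃(S³ | x) ≅ ℤ` at every point (Hatcher 2002, Thm. 3.26). [cite: HatcherAT2002, Thm. 3.26] -/
theorem fundamentalClass_sphere_three_ne_zero (μ : HomologicalOrientation ℤ (𝕊 3) 3) :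
    μ.fundamentalClass ≠ 0 := by
  intro h
  have hF := HomologicalOrientation.isFundamentalClass_fundamentalClass_holds
    (R := ℤ) (X := 𝕊 3) 3 μ
  set x : 𝕊 3 := ⟨EuclideanSpace.single 0 1, by simp⟩ with hxdef
  have hx := hF x
  rw [h, map_zero] at hx
  obtain ⟨e, he⟩ := μ.isGenerator x
  rw [← hx, map_zero] at he
  exact zero_ne_one he

end Sphere

/-! ### The torus class of a tubular neighbourhood -/

namespace Knot.TubularNbhd

variable {K : Knot} (ν : Knot.TubularNbhd K)

/-- The knot lies in its tube: `K(S¹) ⊆ ν(S¹ × ℝ²)` (`ν (x, 0) = K x`). [folklore] -/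
theorem range_knot_subset_range : range ⇑K ⊆ range ⇑ν := by
  rintro _ ⟨x, rfl⟩
  exact ⟨(x, 0), ν.apply_zero x⟩

/-- The open tube and the knot complement cover `S³`. [folklore] -/
theorem interior_range_union_interior_compl :
    interior (range ⇑ν) ∪ interior (range ⇑K)ᶜ = univ := by
  rw [ν.isOpen_range.interior_eq, K.isClosed_range.isOpen_compl.interior_eq]
  exact eq_univ_of_forall fun p ↦ (em (p ∈ range ⇑K)).elim
    (fun h ↦ Or.inl (ν.range_knot_subset_range h)) Or.inr

/-- **The torus class** of the oriented tubular neighbourhood `ν` of the knot `K` for the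
`ℤ`-orientation `μ` of `S³`: the image of the fundamental class `[S³]` under the Mayer–Vietoris
connecting homomorphism `δ : H₃(S³) → H₂(N ∩ (S³ ∖ K))` of the open cover `S³ = N ∪ (S³ ∖ K)`,
`N = ν(S¹ × ℝ²)` (Hatcher 2002, §2.2 p. 150: `δ[z] = [∂x]` for `z = x + y`, `x ⊆ N`, `y ⊆ S³ ∖ K`;
here `∂x` is the boundary torus of a tube around `K`, in the punctured tube `N ∖ K ≃ T² × ℝ`).
[cite: HatcherAT2002, §2.2 pp. 149–150] -/
def torusClass (μ : HomologicalOrientation ℤ (𝕊 3) 3) :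
    singularHomology ℤ ℤ ↥(range ⇑ν ∩ (range ⇑K)ᶜ) 2 :=
  mayerVietoris.δ ℤ ℤ (range ⇑ν) (range ⇑K)ᶜ
    (relativeSingularHomology.isIso_map_of_interior_union_interior_holds ℤ ℤ (𝕊 3))
    ν.interior_range_union_interior_compl 2 μ.fundamentalClass

/-- Unfolding of `torusClass` (any proofs of excision / of the cover condition may be used).
[folklore] -/
theorem torusClass_eq (μ : HomologicalOrientation ℤ (𝕊 3) 3)
    (hexc : relativeSingularHomology.isIso_map_of_interior_union_interior ℤ ℤ (𝕊 3))
    (h : interior (range ⇑ν) ∪ interior (range ⇑K)ᶜ = univ) :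
    ν.torusClass μ = mayerVietoris.δ ℤ ℤ (range ⇑ν) (range ⇑K)ᶜ hexc h 2 μ.fundamentalClass :=
  rfl

/-! #### Non-vanishing -/

/-- `H₃` of the open tube vanishes: `N ≅ S¹ × ℝ²` is a connected non-compact `3`-manifold
(Hatcher 2002, Prop. 3.29). [cite: HatcherAT2002, Prop. 3.29] -/
theorem isZero_singularHomology_range_three : IsZero (singularHomology ℤ ℤ ↥(range ⇑ν) 3) := by
  haveI : ChartedSpace (𝔼 3) ↥(range ⇑ν) := inferInstanceAs
    (ChartedSpace (𝔼 3) ↥(⟨range ⇑ν, ν.isOpen_range⟩ : TopologicalSpace.Opens (𝕊 3)))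
  haveI : ConnectedSpace (𝕊 1) := by
    refine isConnected_iff_connectedSpace.mp (isConnected_sphere ?_ 0 zero_le_one)
    rw [← Module.finrank_eq_rank, finrank_euclideanSpace_fin]
    norm_num
  haveI : Nonempty (𝕊 1) := ⟨circlePoint 0⟩
  haveI : ConnectedSpace ↥(range ⇑ν) :=
    isConnected_iff_connectedSpace.1 (isConnected_range ν.isOpenEmbedding.continuous)
  haveI : NoncompactSpace ↥(range ⇑ν) := by
    rw [← not_compactSpace_iff]
    intro hc
    haveI := hc
    haveI : CompactSpace ((𝕊 1) × 𝔼 2) :=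
      (ν.isOpenEmbedding.isEmbedding.toHomeomorph).symm.compactSpace
    exact not_compactSpace_iff.2 (inferInstance : NoncompactSpace ((𝕊 1) × 𝔼 2)) inferInstance
  exact isZero_singularHomology_of_noncompactSpace_holds ℤ (↥(range ⇑ν)) 3 le_rfl

include ν in
/-- `H₃` of the knot complement vanishes: `S³ ∖ K` is a connected non-compact `3`-manifold
(Hatcher 2002, Prop. 3.29; connectedness: tree `isPreconnected_compl_range`).
[cite: HatcherAT2002, Prop. 3.29] -/
theorem isZero_singularHomology_compl_range_three :
    IsZero (singularHomology ℤ ℤ ↥((range ⇑K)ᶜ) 3) := by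
  haveI : ChartedSpace (𝔼 3) ↥((range ⇑K)ᶜ) := inferInstanceAs (ChartedSpace (𝔼 3) K.complement)
  haveI : ConnectedSpace ↥((range ⇑K)ᶜ) :=
    isConnected_iff_connectedSpace.1 ⟨⟨_, (ν.basePoint).2⟩, ν.isPreconnected_compl_range⟩
  haveI : ConnectedSpace (𝕊 3) := by
    refine isConnected_iff_connectedSpace.mp (isConnected_sphere ?_ 0 zero_le_one)
    rw [← Module.finrank_eq_rank, finrank_euclideanSpace_fin]
    norm_num
  haveI : NoncompactSpace ↥((range ⇑K)ᶜ) := by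
    rw [← not_compactSpace_iff]
    intro hc
    have hK : IsClosed (range ⇑K)ᶜ := (isCompact_iff_compactSpace.2 hc).isClosed
    have hclopen : IsClopen (range ⇑K) := ⟨K.isClosed_range, isClosed_compl_iff.1 hK⟩
    rcases isClopen_iff.1 hclopen with h | h
    · exact (h ▸ mem_range_self (circlePoint 0) : K (circlePoint 0) ∈ (∅ : Set (𝕊 3)))
    · have hb : (ν.basePoint : 𝕊 3) ∉ range ⇑K :=
        (SphereEmbedding.mem_complement_iff K _).1 (ν.basePoint).2
      exact hb (h ▸ mem_univ _)
  exact isZero_singularHomology_of_noncompactSpace_holds ℤ (↥((range ⇑K)ᶜ)) 3 le_rfl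

/-- **The torus class is nonzero.** In the Mayer–Vietoris sequence of `S³ = N ∪ (S³ ∖ K)`,
`H₃(N) ⊕ H₃(S³ ∖ K) = 0 → H₃(S³) →δ H₂(N ∖ K)` is exact (Hatcher 2002, §2.2), so `δ` is injective,
and `[S³] ≠ 0`. [cite: HatcherAT2002, §2.2 pp. 149–150] -/
theorem torusClass_ne_zero (μ : HomologicalOrientation ℤ (𝕊 3) 3) : ν.torusClass μ ≠ 0 := by
  have hexc := relativeSingularHomology.isIso_map_of_interior_union_interior_holds ℤ ℤ (𝕊 3)
  have hcov := ν.interior_range_union_interior_compl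
  have hψ : mayerVietoris.ψ ℤ ℤ (range ⇑ν) (range ⇑K)ᶜ 3 = 0 := by
    refine biprod.hom_ext' _ _ ?_ ?_
    · rw [comp_zero]
      exact ν.isZero_singularHomology_range_three.eq_of_src _ _
    · rw [comp_zero]
      exact ν.isZero_singularHomology_compl_range_three.eq_of_src _ _
  haveI : Mono (mayerVietoris.δ ℤ ℤ (range ⇑ν) (range ⇑K)ᶜ hexc hcov 2) :=
    (mayerVietoris.exact₂_holds ℤ ℤ (range ⇑ν) (range ⇑K)ᶜ hexc hcov 2).mono_g hψ
  intro h
  rw [torusClass_eq ν μ hexc hcov] at h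
  have hinj := (ModuleCat.mono_iff_injective
    (mayerVietoris.δ ℤ ℤ (range ⇑ν) (range ⇑K)ᶜ hexc hcov 2)).1 inferInstance
  exact fundamentalClass_sphere_three_ne_zero μ (hinj (h.trans (map_zero _).symm))

/-! #### The torus class as a retract of a Mayer–Vietoris class of a larger cover -/

/-- A point of the punctured tube `N ∖ K` (the base point `ν (1, e₀)` of `ν`). [folklore] -/
def puncturedTubePoint : ↥(range ⇑ν ∩ (range ⇑K)ᶜ) :=
  ⟨ν.basePoint, ⟨(circlePoint 0, framingBaseVector), rfl⟩, (ν.basePoint).2⟩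

variable {T X' D : Set (𝕊 3)}

/-- The retraction of `T ∩ X'` onto the punctured tube `N ∖ K`, when `N ⊆ T ⊆ N ∪ D` with `D` open
and disjoint from `N`, and `X' ⊆ S³ ∖ K`: the identity on `N ∩ X'`, constant on `D ∩ X'`.
[folklore] -/
def retractInter (hD : IsOpen D) (hTsub : T ⊆ range ⇑ν ∪ D) (hDν : Disjoint (range ⇑ν) D)
    (hX' : X' ⊆ (range ⇑K)ᶜ) : C(↥(T ∩ X'), ↥(range ⇑ν ∩ (range ⇑K)ᶜ)) :=
  clopenRetract (S := T ∩ X') (C := range ⇑ν) (D := D) ν.isOpen_range hD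
    (fun _ hx ↦ hTsub hx.1) (fun _ _ hxC hxD ↦ Set.disjoint_left.1 hDν hxC hxD)
    (fun _ hx hxC ↦ ⟨hxC, hX' hx.2⟩) ν.puncturedTubePoint

/-- **The torus class is the retract of the Mayer–Vietoris class of any larger cover.** Let
`N ⊆ T ⊆ N ∪ D` with `T`, `D` open, `D ∩ N = ∅`, and `X' ⊆ S³ ∖ K` open with `T ∪ X' = S³`.
Then the retraction `T ∩ X' → N ∖ K` maps `δ_{(T, X')}[S³]` to `torusClass ν μ`:
naturality of the Mayer–Vietoris connecting map (Hatcher 2002, §2.2 p. 150) for the two maps of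
covers `(T, X') → (T, S³ ∖ K) ← (N, S³ ∖ K)` and the retraction `(N ∖ K) ⊔ (D ∩ T) → N ∖ K`.
[cite: HatcherAT2002, §2.2 p. 150] -/
theorem map_retractInter_δ_eq_torusClass (μ : HomologicalOrientation ℤ (𝕊 3) 3)
    (hT : IsOpen T) (hX'o : IsOpen X') (hD : IsOpen D) (hνT : range ⇑ν ⊆ T)
    (hTsub : T ⊆ range ⇑ν ∪ D) (hDν : Disjoint (range ⇑ν) D) (hX' : X' ⊆ (range ⇑K)ᶜ)
    (hexc : relativeSingularHomology.isIso_map_of_interior_union_interior ℤ ℤ (𝕊 3))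
    (hcov : interior T ∪ interior X' = univ) :
    singularHomology.map ℤ ℤ (ν.retractInter hD hTsub hDν hX') 2
        (mayerVietoris.δ ℤ ℤ T X' hexc hcov 2 μ.fundamentalClass) = ν.torusClass μ := by
  -- the intermediate cover `(T, S³ ∖ K)`
  have hcovT : interior T ∪ interior (range ⇑K)ᶜ = univ := by
    rw [hT.interior_eq, K.isClosed_range.isOpen_compl.interior_eq]
    refine eq_univ_of_forall fun p ↦ ?_
    have hp : p ∈ interior T ∪ interior X' := hcov ▸ mem_univ p
    rw [hT.interior_eq, hX'o.interior_eq] at hp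
    exact hp.imp id (fun h ↦ hX' h)
  have hcovN := ν.interior_range_union_interior_compl
  -- naturality for `(T, X') → (T, S³ ∖ K)`
  have hU₁ : MapsTo (ContinuousMap.id (𝕊 3)) T T := mapsTo_id T
  have hV₁ : MapsTo (ContinuousMap.id (𝕊 3)) X' (range ⇑K)ᶜ := fun x hx ↦ hX' hx
  have nat₁ := mayerVietoris.δ_naturality_holds ℤ ℤ hexc hexc (ContinuousMap.id (𝕊 3)) hU₁ hV₁
    hcov hcovT 2
  -- naturality for `(N, S³ ∖ K) → (T, S³ ∖ K)`
  have hU₂ : MapsTo (ContinuousMap.id (𝕊 3)) (range ⇑ν) T := fun x hx ↦ hνT hx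
  have hV₂ : MapsTo (ContinuousMap.id (𝕊 3)) (range ⇑K)ᶜ (range ⇑K)ᶜ := mapsTo_id _
  have nat₂ := mayerVietoris.δ_naturality_holds ℤ ℤ hexc hexc (ContinuousMap.id (𝕊 3)) hU₂ hV₂
    hcovN hcovT 2
  rw [singularHomology.map_id, Category.id_comp] at nat₁ nat₂
  have e₁ := congrArg (fun φ ↦ φ μ.fundamentalClass) nat₁
  have e₂ := congrArg (fun φ ↦ φ μ.fundamentalClass) nat₂
  simp only [ModuleCat.comp_apply] at e₁ e₂
  -- the retraction `T ∩ (S³ ∖ K) → N ∖ K`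
  set ρ : C(↥(T ∩ (range ⇑K)ᶜ), ↥(range ⇑ν ∩ (range ⇑K)ᶜ)) :=
    clopenRetract (S := T ∩ (range ⇑K)ᶜ) (C := range ⇑ν) (D := D) ν.isOpen_range hD
      (fun _ hx ↦ hTsub hx.1) (fun _ _ hxC hxD ↦ Set.disjoint_left.1 hDν hxC hxD)
      (fun _ hx hxC ↦ ⟨hxC, hx.2⟩) ν.puncturedTubePoint with hρ
  -- `ρ ∘ (N ∖ K ↪ T ∖ K) = id`
  have hρ₂ : ρ.comp (subsetRestrict (ContinuousMap.id (𝕊 3)) (hU₂.inter_inter hV₂)) =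
      ContinuousMap.id _ := by
    rw [hρ]
    refine ContinuousMap.ext fun x ↦ Subtype.ext ?_
    rw [ContinuousMap.comp_apply]
    exact clopenRetract_apply_of_mem _ _ _ _ _ _ _ x.2.1
  -- `ρ ∘ (T ∩ X' ↪ T ∖ K) = retractInter`
  have hρ₁ : ρ.comp (subsetRestrict (ContinuousMap.id (𝕊 3)) (hU₁.inter_inter hV₁)) =
      ν.retractInter hD hTsub hDν hX' := by
    rw [hρ]
    refine ContinuousMap.ext fun x ↦ ?_
    rw [ContinuousMap.comp_apply]
    by_cases hx : (x : 𝕊 3) ∈ range ⇑ν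
    · refine Subtype.ext ?_
      rw [retractInter, clopenRetract_apply_of_mem _ _ _ _ _ _ _ hx]
      exact clopenRetract_apply_of_mem _ _ _ _ _ _ _ hx
    · rw [retractInter, clopenRetract_apply_of_not_mem _ _ _ _ _ _ _ hx]
      exact clopenRetract_apply_of_not_mem _ _ _ _ _ _ _ hx
  -- assemble
  have hρ₂' : singularHomology.map ℤ ℤ
      (subsetRestrict (ContinuousMap.id (𝕊 3)) (hU₂.inter_inter hV₂)) 2 ≫
        singularHomology.map ℤ ℤ ρ 2 = 𝟙 _ := by
    rw [← singularHomology.map_comp, hρ₂, singularHomology.map_id]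
  rw [← hρ₁, singularHomology.map_comp, ModuleCat.comp_apply, e₁, ← e₂, ← ModuleCat.comp_apply,
    hρ₂', ModuleCat.id_apply, torusClass_eq ν μ hexc hcovN]

end Knot.TubularNbhd

/-! ### Cancellation of the two torus classes of a link -/

namespace Knot.TubularNbhd

variable {K J : Knot} (νK : Knot.TubularNbhd K) (νJ : Knot.TubularNbhd J)

/-- If the tubes of `K` and `J` are disjoint, the punctured tube of `K` lies in `S³ ∖ (K ∪ J)`.
[folklore] -/
theorem inter_compl_subset_compl_union (hdisj : Disjoint (range ⇑νK) (range ⇑νJ)) :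
    range ⇑νK ∩ (range ⇑K)ᶜ ⊆ (range ⇑K ∪ range ⇑J)ᶜ := by
  rintro x ⟨hxN, hxK⟩ (hx | hx)
  · exact hxK hx
  · exact Set.disjoint_left.1 hdisj hxN (νJ.range_knot_subset_range hx)

/-- If the tubes of `K` and `J` are disjoint, the punctured tube of `J` lies in `S³ ∖ (K ∪ J)`.
[folklore] -/
theorem inter_compl_subset_compl_union' (hdisj : Disjoint (range ⇑νK) (range ⇑νJ)) :
    range ⇑νJ ∩ (range ⇑J)ᶜ ⊆ (range ⇑K ∪ range ⇑J)ᶜ := by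
  rintro x ⟨hxN, hxJ⟩ (hx | hx)
  · exact Set.disjoint_left.1 hdisj (νK.range_knot_subset_range hx) hxN
  · exact hxJ hx

/-- **The torus classes of a two-component link cancel in the link complement.** For knots `K`,
`J` with disjoint oriented tubular neighbourhoods `N_K = ν_K(S¹ × ℝ²)`, `N_J = ν_J(S¹ × ℝ²)` and
any `ℤ`-orientation `μ` of `S³`:
`i_* (torusClass ν_K μ) + i_* (torusClass ν_J μ) = 0` in `H₂(S³ ∖ (K ∪ J); ℤ)`.
Mayer–Vietoris (Hatcher 2002, §2.2) for `S³ = T ∪ X'`, `T = N_K ∪ N_J`, `X' = S³ ∖ (K ∪ J)`,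
`T ∩ X' = (N_K ∖ K) ⊔ (N_J ∖ J)`: `δ[S³] ↦ 0 ∈ H₂(X')` as `δ ≫ φ = 0`; `δ[S³]` is a sum of classes
pushed from the two pieces (additivity, Hatcher Prop. 2.6), which the two retractions identify
with the torus classes (`map_retractInter_δ_eq_torusClass`). This is the relation
`[∂N(K)] + [∂N(J)] = ∂[M] ↦ 0` for the link exterior `M`, the homological core of the symmetry of
the linking number (Rolfsen 1976, §5.D Thm. 5.D.1). [cite: HatcherAT2002, §2.2 pp. 149–150]
[cite: Rolfsen1976, §5.D Thm 5.D.1] -/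
theorem map_torusClass_add_map_torusClass_eq_zero (hdisj : Disjoint (range ⇑νK) (range ⇑νJ))
    (μ : HomologicalOrientation ℤ (𝕊 3) 3) :
    singularHomology.map ℤ ℤ
        (subsetInclusion (νK.inter_compl_subset_compl_union νJ hdisj)) 2 (νK.torusClass μ) +
      singularHomology.map ℤ ℤ
        (subsetInclusion (νK.inter_compl_subset_compl_union' νJ hdisj)) 2
          (νJ.torusClass μ) = 0 := by
  have hexc := relativeSingularHomology.isIso_map_of_interior_union_interior_holds ℤ ℤ (𝕊 3)
  -- the cover `(T, X')`
  set T : Set (𝕊 3) := range ⇑νK ∪ range ⇑νJ with hT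
  set X' : Set (𝕊 3) := (range ⇑K ∪ range ⇑J)ᶜ with hX'
  have hTo : IsOpen T := νK.isOpen_range.union νJ.isOpen_range
  have hX'o : IsOpen X' := (K.isClosed_range.union J.isClosed_range).isOpen_compl
  have hcov : interior T ∪ interior X' = univ := by
    rw [hTo.interior_eq, hX'o.interior_eq]
    refine eq_univ_of_forall fun p ↦ ?_
    by_cases hp : p ∈ range ⇑K ∪ range ⇑J
    · exact Or.inl (hp.elim (fun h ↦ Or.inl (νK.range_knot_subset_range h))
        fun h ↦ Or.inr (νJ.range_knot_subset_range h))
    · exact Or.inr hp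
  -- (1) `δ[S³] ↦ 0` in `H₂(X')`
  have h₁ : singularHomology.map ℤ ℤ (subsetInclusion (Set.inter_subset_right : T ∩ X' ⊆ X')) 2
      (mayerVietoris.δ ℤ ℤ T X' hexc hcov 2 μ.fundamentalClass) = 0 := by
    have h := mayerVietoris.δ_comp_φ ℤ ℤ T X' hexc hcov 2
    have h' := congrArg (fun φ ↦ φ ≫ (biprod.snd : _ ⟶ singularHomology ℤ ℤ (↥X') 2)) h
    simp only [mayerVietoris.φ, Category.assoc, biprod.lift_snd, zero_comp,
      Preadditive.comp_neg, neg_eq_zero] at h'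
    have h'' := congrArg (fun φ ↦ φ μ.fundamentalClass) h'
    simpa only [ModuleCat.comp_apply, ModuleCat.hom_zero, LinearMap.zero_apply] using h''
  -- (2) the two retractions recover the torus classes
  have hPK : range ⇑νK ∩ (range ⇑K)ᶜ ⊆ X' := νK.inter_compl_subset_compl_union νJ hdisj
  have hPJ : range ⇑νJ ∩ (range ⇑J)ᶜ ⊆ X' := νK.inter_compl_subset_compl_union' νJ hdisj
  have hX'K : X' ⊆ (range ⇑K)ᶜ := compl_subset_compl.2 subset_union_left
  have hX'J : X' ⊆ (range ⇑J)ᶜ := compl_subset_compl.2 subset_union_right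
  have hTK : T ⊆ range ⇑νK ∪ range ⇑νJ := subset_rfl
  have hTJ : T ⊆ range ⇑νJ ∪ range ⇑νK := by rw [Set.union_comm]
  have rK := νK.map_retractInter_δ_eq_torusClass μ hTo hX'o νJ.isOpen_range subset_union_left hTK
    hdisj hX'K hexc hcov
  have rJ := νJ.map_retractInter_δ_eq_torusClass μ hTo hX'o νK.isOpen_range subset_union_right hTJ
    hdisj.symm hX'J hexc hcov
  generalize (mayerVietoris.δ ℤ ℤ T X' hexc hcov 2) μ.fundamentalClass = ξ at h₁ rK rJ
  -- (3) additivity: `ξ = i_K α + i_J β`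
  have hAS : range ⇑νK ∩ (range ⇑K)ᶜ ⊆ T ∩ X' := fun x hx ↦ ⟨Or.inl hx.1, hPK hx⟩
  have hBS : range ⇑νJ ∩ (range ⇑J)ᶜ ⊆ T ∩ X' := fun x hx ↦ ⟨Or.inr hx.1, hPJ hx⟩
  have hAB : Disjoint (range ⇑νK ∩ (range ⇑K)ᶜ) (range ⇑νJ ∩ (range ⇑J)ᶜ) :=
    hdisj.mono inter_subset_left inter_subset_left
  have hS : T ∩ X' ⊆ range ⇑νK ∩ (range ⇑K)ᶜ ∪ range ⇑νJ ∩ (range ⇑J)ᶜ := by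
    rintro x ⟨hxT | hxT, hxX⟩
    · exact Or.inl ⟨hxT, hX'K hxX⟩
    · exact Or.inr ⟨hxT, hX'J hxX⟩
  obtain ⟨α, β, hαβ⟩ := singularHomology.exists_eq_map_add_map_of_disjoint_open
    (νK.isOpen_range.inter K.isClosed_range.isOpen_compl)
    (νJ.isOpen_range.inter J.isClosed_range.isOpen_compl) hAB hAS hBS hS 2 ξ
  -- (4) the retractions on the two pieces: identity / constant
  have cKK : (νK.retractInter νJ.isOpen_range hTK hdisj hX'K).comp (subsetInclusion hAS) =
      ContinuousMap.id _ := by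
    refine ContinuousMap.ext fun x ↦ Subtype.ext ?_
    rw [ContinuousMap.comp_apply, retractInter]
    exact clopenRetract_apply_of_mem _ _ _ _ _ _ _ x.2.1
  have cKJ : ∀ x, (νK.retractInter νJ.isOpen_range hTK hdisj hX'K).comp (subsetInclusion hBS) x =
      νK.puncturedTubePoint := fun x ↦ by
    rw [ContinuousMap.comp_apply, retractInter]
    exact clopenRetract_apply_of_not_mem _ _ _ _ _ _ _
      (fun h ↦ Set.disjoint_left.1 hdisj h x.2.1)
  have cJJ : (νJ.retractInter νK.isOpen_range hTJ hdisj.symm hX'J).comp (subsetInclusion hBS) =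
      ContinuousMap.id _ := by
    refine ContinuousMap.ext fun x ↦ Subtype.ext ?_
    rw [ContinuousMap.comp_apply, retractInter]
    exact clopenRetract_apply_of_mem _ _ _ _ _ _ _ x.2.1
  have cJK : ∀ x, (νJ.retractInter νK.isOpen_range hTJ hdisj.symm hX'J).comp
      (subsetInclusion hAS) x = νJ.puncturedTubePoint := fun x ↦ by
    rw [ContinuousMap.comp_apply, retractInter]
    exact clopenRetract_apply_of_not_mem _ _ _ _ _ _ _
      (fun h ↦ Set.disjoint_left.1 hdisj x.2.1 h)
  have hαK : νK.torusClass μ = α := by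
    rw [← rK, hαβ, map_add, ← ModuleCat.comp_apply, ← ModuleCat.comp_apply,
      ← singularHomology.map_comp, ← singularHomology.map_comp, cKK, singularHomology.map_id,
      ModuleCat.id_apply, singularHomology.map_eq_zero_of_forall_eq _ _ cKJ two_ne_zero]
    simp
  have hβJ : νJ.torusClass μ = β := by
    rw [← rJ, hαβ, map_add, ← ModuleCat.comp_apply, ← ModuleCat.comp_apply,
      ← singularHomology.map_comp, ← singularHomology.map_comp, cJJ, singularHomology.map_id,
      ModuleCat.id_apply, singularHomology.map_eq_zero_of_forall_eq _ _ cJK two_ne_zero]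
    simp
  -- (5) conclude
  rw [hαK, hβJ]
  rw [hαβ, map_add, ← ModuleCat.comp_apply, ← ModuleCat.comp_apply, ← singularHomology.map_comp,
    ← singularHomology.map_comp] at h₁
  exact h₁

end Knot.TubularNbhd

end Literature.Topology.FourManifolds
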